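import Literature.Probability.RandomPlanarGeometry.HexSAWEndpointKesten
import Literature.Probability.RandomPlanarGeometry.HexSAWBrickWallBridgeSurgery
import HarnessLib

/-!
# The threefold symmetry of the fixed-endpoint counts at the origin of `ℍ` and the polygon two-step ratio
# `p_{n+2}(ℍ)/p_n(ℍ) → 2 + √2` (conditional on the polygon lower envelope)

Topic `Literature/Probability/RandomPlanarGeometry` (lane «pcv-sawmu», door «HEX-ENDPOINT-RATIO-2»; continues
`HexSAWEndpointKesten.lean` — `HV.endFin x N`, the envelope schema `HexEndpointLo`, Theorem 7.3.4 (b) on `ℍ`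
`hexEndpointRatioTwo_of` — and `HexSAWBrickWallBridgeSurgery.lean` — the transport `toBW` of `ℍ`-lists to brick-wall vertex
functions, `toBW_injOn`, `toBW_mem_saws`).

Source: N. Madras, G. Slade, *The Self-Avoiding Walk* (1993), Theorem 7.3.4 (c) p. 248: "`lim_{N→∞} q_{2N+2}/q_{2N} = μ²`"
for the polygon counts of `ℤ^d`, "a direct consequence of part (b) and the basic relation (3.2.1)" (p. 63:
`2N q_N = 2d c_{N−1}(0,e)`, rooted polygons = walks ending next to the origin, the `2d` neighbours being equivalent by
symmetry). On the honeycomb lattice the role of the coordinate symmetries of `ℤ^d` is played by the ORDER-3 ROTATION about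
a vertex: in the coordinate model `hvGraph` on `HV = ℤ × ℤ × Bool` it is the graph automorphism
`rot3 : (a, b, false) ↦ (−a−b, a, false), (a, b, true) ↦ (−a−b−1, a, true)`, which fixes the origin `(0,0,false)` and
permutes its three neighbours `(0,0,true) → (−1,0,true) → (0,−1,true) → (0,0,true)` cyclically. Consequences: the counts
`#E_N(z)` agree for the three neighbours `z` of the origin; the number of `N`-step walks ending NEXT TO the origin
(`= (N+1)`-step rooted oriented polygons through the origin, (3.2.1)) is `3 · #E_N((0,0,true))`; and Theorem 7.3.4 (b) on `ℍ`
for `x = z` gives the POLYGON two-step ratio `p_{n+2}(ℍ)/p_n(ℍ) → 2 + √2` — conditional on the lower envelope of the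
polygon counts (the lane's HEX-SAP growth theorem, brick-wall frame; the brick-wall form of the count is supplied here by
`card_adjEndFin_eq_card_bw`, so that the discharge is a rewrite once that theorem is in the tree).

Status in print: `ℤ^d` — M–S Thm 7.3.4 (c) (Kesten 1963); `ℍ` — nothing printed for polygon-count ratios (lane lit-1 cell
2026-08-22T23:54:47Z; Jensen's honeycomb-polygon series estimate `x_c² = 0.2928932…` numerically only); first text for `ℍ`,
consolidation-grade, CONDITIONAL on `HexAdjEndLo c` (displayed).

## Contents (namespace `Literature.Probability.RandomPlanarGeometry.SAW.HV`; all PROVED, axioms standard)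

* `rot3 : hvGraph ≃g hvGraph`, `rot3_apply`, `rot3_hvOrigin`; `card_endFin_iso` (any automorphism fixing the origin),
  `card_endFin_rot3`; the neighbours `nb0 nb1 nb2` of the origin and `card_endFin_nb1`, `card_endFin_nb2` (`= #E_N(nb0)`);
* `adjEndFin N` (walks ending next to the origin), `card_adjEndFin : #adjEndFin N = 3 · #E_N(nb0)`,
  **`card_adjEndFin_eq_card_bw`** (`= #{ρ ∈ HexBW.saws N : ρ N ~ 0}`, the brick-wall form);
* `HexAdjEndLo c` (lower envelope of the walks ending next to the origin, odd lengths — hypothesis schema),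
  `hexEndpointLo_of_adjEndLo` (`⇒ HexEndpointLo z (c+2) 1` for each neighbour `z`);
* **`hexPolygonRatioTwo_of`** — `#E_{2m+3}(z)/#E_{2m+1}(z) → 2 + √2` for each neighbour `z` of the origin, and
  **`hexAdjEndRatioTwo_of`** — `#adjEndFin (2m+3)/#adjEndFin (2m+1) → 2 + √2`, both given `HexAdjEndLo c`.
-/

noncomputable section

open Finset Filter Topology Literature.Probability.LatticeModels SimpleGraph
open scoped BigOperators

namespace Literature.Probability.RandomPlanarGeometry.SAW.HV

/-! ### The order-3 rotation about the origin vertex -/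

/-- **The rotation by `2π/3` about the vertex `(0,0,false)` of `ℍ`**, as an automorphism of the coordinate model:
`(a, b, false) ↦ (−a−b, a, false)`, `(a, b, true) ↦ (−a−b−1, a, true)`. [cite: DuminilCopinSmirnov2012, §1 (the hexagonal lattice; its rotational symmetry)] -/
def rot3 : hvGraph ≃g hvGraph where
  toFun v := (-v.1 - v.2.1 - (if v.2.2 then 1 else 0), v.1, v.2.2)
  invFun v := (v.2.1, -v.1 - v.2.1 - (if v.2.2 then 1 else 0), v.2.2)
  left_inv v := by
    obtain ⟨a, b, c⟩ := v
    refine Prod.ext rfl (Prod.ext ?_ rfl)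
    cases c <;> simp only [if_true, if_false, Bool.false_eq_true] <;> ring
  right_inv v := by
    obtain ⟨a, b, c⟩ := v
    refine Prod.ext ?_ (Prod.ext rfl rfl)
    cases c <;> simp only [if_true, if_false, Bool.false_eq_true] <;> ring
  map_rel_iff' := by
    rintro ⟨a, b, c⟩ ⟨a', b', c'⟩
    cases c <;> cases c' <;> simp [hvGraph_adj, HV.AdjRel] <;> omega

/-- `rot3` in coordinates. [cite: DuminilCopinSmirnov2012, §1 (the hexagonal lattice; its rotational symmetry)] -/
theorem rot3_apply (v : HV) : rot3 v = (-v.1 - v.2.1 - (if v.2.2 then 1 else 0), v.1, v.2.2) := rfl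

/-- `rot3` fixes the origin. [cite: DuminilCopinSmirnov2012, §1 (the hexagonal lattice; its rotational symmetry)] -/
theorem rot3_hvOrigin : rot3 hvOrigin = hvOrigin := by
  simp [rot3_apply, hvOrigin]

/-- The three neighbours of the origin `(0,0,false)`: `nb0 = (0,0,true)`. [cite: MadrasSlade1993, §3.2 (3.2.1) p. 63 (the neighbours of the origin are equivalent by symmetry)] -/
def nb0 : HV := (0, 0, true)

/-- The three neighbours of the origin: `nb1 = (−1,0,true)`. [cite: MadrasSlade1993, §3.2 (3.2.1) p. 63 (the neighbours of the origin are equivalent by symmetry)] -/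
def nb1 : HV := (-1, 0, true)

/-- The three neighbours of the origin: `nb2 = (0,−1,true)`. [cite: MadrasSlade1993, §3.2 (3.2.1) p. 63 (the neighbours of the origin are equivalent by symmetry)] -/
def nb2 : HV := (0, -1, true)

/-- `rot3 nb0 = nb1`. [cite: DuminilCopinSmirnov2012, §1 (the hexagonal lattice; its rotational symmetry)] -/
theorem rot3_nb0 : rot3 nb0 = nb1 := by simp [rot3_apply, nb0, nb1]

/-- `rot3 nb1 = nb2`. [cite: DuminilCopinSmirnov2012, §1 (the hexagonal lattice; its rotational symmetry)] -/
theorem rot3_nb1 : rot3 nb1 = nb2 := by simp [rot3_apply, nb1, nb2]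

/-- `rot3 nb2 = nb0`. [cite: DuminilCopinSmirnov2012, §1 (the hexagonal lattice; its rotational symmetry)] -/
theorem rot3_nb2 : rot3 nb2 = nb0 := by simp [rot3_apply, nb2, nb0]

/-- The neighbours of the origin are exactly `nb0, nb1, nb2`. [cite: MadrasSlade1993, §3.2 (3.2.1) p. 63 (the neighbours of the origin are equivalent by symmetry)] -/
theorem adj_hvOrigin_iff (v : HV) : hvGraph.Adj hvOrigin v ↔ v = nb0 ∨ v = nb1 ∨ v = nb2 := by
  rw [hvGraph_adj_iff_mem_nbrs]
  simp [hvOrigin, HV.nbrs, nb0, nb1, nb2]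

/-! ### Invariance of the fixed-endpoint counts under automorphisms fixing the origin -/

section Iso

variable {N : ℕ} {x : HV}

/-- An automorphism of `ℍ` fixing the origin maps `E_N(x)` into `E_N(φ x)`. [cite: MadrasSlade1993, §3.2 (3.2.1) p. 63 (the neighbours of the origin are equivalent by symmetry)] -/
theorem map_mem_endFin (φ : hvGraph ≃g hvGraph) (hφ : φ hvOrigin = hvOrigin) {ω : List HV} (hω : ω ∈ endFin x N) :
    ω.map φ ∈ endFin (φ x) N := by
  obtain ⟨hω', hx⟩ := mem_endFin.1 hω
  refine mem_endFin.2 ⟨?_, ?_⟩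
  · rw [mem_sawFin_iff] at hω' ⊢
    have h := (map_mem_sawLists_iff φ (v := hvOrigin) (n := N) (l := ω)).2 hω'
    rwa [hφ] at h
  · rw [← hx, ← List.getD_map (f := φ), hφ]

/-- **`#E_N(φ x) = #E_N(x)`** for every automorphism `φ` of `ℍ` fixing the origin. [cite: MadrasSlade1993, §3.2 (3.2.1) p. 63 (the neighbours of the origin are equivalent by symmetry)] -/
theorem card_endFin_iso (φ : hvGraph ≃g hvGraph) (hφ : φ hvOrigin = hvOrigin) (x : HV) (N : ℕ) :
    #(endFin (φ x) N) = #(endFin x N) := by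
  have hφ' : φ.symm hvOrigin = hvOrigin := φ.injective (by rw [RelIso.apply_symm_apply, hφ])
  symm
  refine Finset.card_nbij' (fun ω => ω.map φ) (fun ω => ω.map φ.symm) (fun ω hω => map_mem_endFin φ hφ hω)
    (fun ω hω => ?_) (fun ω _ => by simp) (fun ω _ => by simp)
  have h := map_mem_endFin φ.symm hφ' hω
  rwa [RelIso.symm_apply_apply] at h

/-- `#E_N(rot3 x) = #E_N(x)`. [cite: MadrasSlade1993, §3.2 (3.2.1) p. 63 (the neighbours of the origin are equivalent by symmetry)] -/
theorem card_endFin_rot3 (x : HV) (N : ℕ) : #(endFin (rot3 x) N) = #(endFin x N) :=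
  card_endFin_iso rot3 rot3_hvOrigin x N

/-- `#E_N(nb1) = #E_N(nb0)`. [cite: MadrasSlade1993, §3.2 (3.2.1) (equivalence of the neighbours of the origin)] -/
theorem card_endFin_nb1 (N : ℕ) : #(endFin nb1 N) = #(endFin nb0 N) := by
  rw [← rot3_nb0, card_endFin_rot3]

/-- `#E_N(nb2) = #E_N(nb0)`. [cite: MadrasSlade1993, §3.2 (3.2.1) (equivalence of the neighbours of the origin)] -/
theorem card_endFin_nb2 (N : ℕ) : #(endFin nb2 N) = #(endFin nb0 N) := by
  rw [← rot3_nb1, card_endFin_rot3, card_endFin_nb1]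

end Iso

/-! ### Walks ending next to the origin (rooted polygons through the origin) -/

section AdjEnd

/-- **`A_N`: the `N`-step self-avoiding walks of `ℍ` from the origin whose last vertex is ADJACENT to the origin** (for `N ≥ 2`,
the rooted oriented `(N+1)`-gons through the origin; Madras–Slade (3.2.1)). [cite: MadrasSlade1993, §3.2, (3.2.1) p. 63] -/
def adjEndFin (N : ℕ) : Finset (List HV) := (sawFin hvOrigin N).filter fun ω => hvGraph.Adj hvOrigin (ω.getD N hvOrigin)

/-- Membership in `A_N`. [cite: MadrasSlade1993, §3.2, (3.2.1)] -/
theorem mem_adjEndFin {N : ℕ} {ω : List HV} :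
    ω ∈ adjEndFin N ↔ ω ∈ sawFin hvOrigin N ∧ hvGraph.Adj hvOrigin (ω.getD N hvOrigin) := mem_filter

/-- `A_N` is the disjoint union of `E_N(nb0)`, `E_N(nb1)`, `E_N(nb2)`. [cite: MadrasSlade1993, §3.2, (3.2.1)] -/
theorem adjEndFin_eq (N : ℕ) : adjEndFin N = endFin nb0 N ∪ endFin nb1 N ∪ endFin nb2 N := by
  ext ω
  simp only [mem_adjEndFin, mem_union, mem_endFin, adj_hvOrigin_iff]
  tauto

/-- **`#A_N = 3 · #E_N(nb0)`** (threefold symmetry). [cite: MadrasSlade1993, §3.2, (3.2.1) («2d c_{N−1}(0,e)»)] -/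
theorem card_adjEndFin (N : ℕ) : #(adjEndFin N) = 3 * #(endFin nb0 N) := by
  have hd01 : Disjoint (endFin nb0 N) (endFin nb1 N) := by
    rw [Finset.disjoint_left]
    intro ω h0 h1
    have e := (mem_endFin.1 h0).2.symm.trans (mem_endFin.1 h1).2
    simp [nb0, nb1] at e
  have hd02 : Disjoint (endFin nb0 N ∪ endFin nb1 N) (endFin nb2 N) := by
    rw [Finset.disjoint_left]
    intro ω h h2
    rcases mem_union.1 h with h0 | h1
    · have e := (mem_endFin.1 h0).2.symm.trans (mem_endFin.1 h2).2
      simp [nb0, nb2] at e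
    · have e := (mem_endFin.1 h1).2.symm.trans (mem_endFin.1 h2).2
      simp [nb1, nb2] at e
  rw [adjEndFin_eq, card_union_of_disjoint hd02, card_union_of_disjoint hd01, card_endFin_nb1, card_endFin_nb2]
  ring

open Classical in
/-- **The brick-wall form of `#A_N`**: `#A_N = #{ρ ∈ HexBW.saws N : ρ(N) ~ 0}` (the lane's HEX-SAP count `HexBW.adjEndCount N`
is this right-hand side), by the transport `toBW` of `HexSAWBrickWallBridgeSurgery`.
[cite: EntingJensen2009, §7.4.2, Fig. 7.10 (brick-wall form of the hexagonal lattice)] -/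
theorem card_adjEndFin_eq_card_bw (N : ℕ) :
    #(adjEndFin N) = #((HexBW.saws N).filter fun ρ => brickWallGraph.Adj (ρ N) 0) := by
  have himage : (adjEndFin N).image (toBW N) = (HexBW.saws N).filter fun ρ => brickWallGraph.Adj (ρ N) 0 := by
    ext f
    rw [Finset.mem_image, Finset.mem_filter]
    simp only [mem_adjEndFin]
    constructor
    · rintro ⟨ω, ⟨hω, hadj⟩, rfl⟩
      refine ⟨toBW_mem_saws hω, ?_⟩
      rw [toBW_apply, min_self, ← hvToBW_hvOrigin, ← bwIso_symm_apply, ← bwIso_symm_apply,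
        bwIso.symm.map_rel_iff]
      exact hadj.symm
    · rintro ⟨hf, hadj⟩
      have hf' : f ∈ HexBW.ofList N '' sawLists brickWallGraph (0 : Site 2) N := by
        rw [HexBW.ofList_image]; exact Finset.mem_coe.2 hf
      obtain ⟨l, hl, rfl⟩ := hf'
      set ω : List HV := l.map bwToHV with hωdef
      have hωl : ω.map hvToBW = l := by
        rw [hωdef, List.map_map]
        convert List.map_id l
        funext x
        exact hvToBW_bwToHV x
      have hω : ω ∈ sawFin hvOrigin N := by
        rw [mem_sawFin_iff]
        have h := (map_mem_sawLists_iff bwIso (v := (0 : Site 2)) (n := N) (l := l)).2 hl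
        have e : (⇑bwIso : Site 2 → HV) = bwToHV := funext bwIso_apply
        rwa [e, bwToHV_zero] at h
      have htoBW : toBW N ω = HexBW.ofList N l := by rw [toBW, hωl]
      refine ⟨ω, ⟨hω, ?_⟩, htoBW⟩
      rw [← htoBW, toBW_apply, min_self, ← hvToBW_hvOrigin, ← bwIso_symm_apply, ← bwIso_symm_apply,
        bwIso.symm.map_rel_iff] at hadj
      exact hadj.symm
  have hinj : Set.InjOn (toBW N) ↑(adjEndFin N) :=
    (toBW_injOn N).mono fun ω hω => Finset.mem_coe.2 (mem_adjEndFin.1 (Finset.mem_coe.1 hω)).1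
  rw [← himage, Finset.card_image_of_injOn hinj]

end AdjEnd

/-! ### The polygon two-step ratio, conditional on the polygon lower envelope -/

section Polygon

/-- **Lower envelope of the walks ending next to the origin, odd lengths** (hypothesis schema; on `ℍ` it is the
polygon-growth theorem `|log p_n − n log μ_ℍ| ≤ C√n` of the lane's HEX-SAP line): for all large `m`,
`e^{-c√(2m+1)} μ_ℍ^{2m+1} ≤ #A_{2m+1}`. [cite: MadrasSlade1993, Theorem 3.2.3 / (3.2.5) p. 65 (polygon growth with the `e^{-c√n}` correction)] -/
def HexAdjEndLo (c : ℝ) : Prop :=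
  ∃ m₀ : ℕ, ∀ m : ℕ, m₀ ≤ m →
    Real.exp (-(c * Real.sqrt ((2 * m + 1 : ℕ) : ℝ))) * hexConnectiveConstant ^ (2 * m + 1) ≤ #(adjEndFin (2 * m + 1))

/-- `e^{-2√N} ≤ 1/3` for `N ≥ 1`. [folklore] -/
private theorem exp_neg_two_sqrt_le {N : ℕ} (hN : 1 ≤ N) : Real.exp (-(2 * Real.sqrt (N : ℝ))) ≤ 1 / 3 := by
  have hs : (1 : ℝ) ≤ Real.sqrt (N : ℝ) := by
    rw [Real.le_sqrt (by norm_num) (Nat.cast_nonneg _)]; exact_mod_cast hN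
  have h1 : Real.exp (-(2 * Real.sqrt (N : ℝ))) ≤ Real.exp (-2) := Real.exp_le_exp.2 (by linarith)
  have h2 : Real.exp (-2 : ℝ) ≤ 1 / 3 := by
    rw [Real.exp_neg, inv_eq_one_div]
    apply div_le_div_of_nonneg_left (by norm_num) (by norm_num)
    have := Real.add_one_le_exp (2 : ℝ)
    linarith
  exact h1.trans h2

/-- **From the polygon envelope to the single-neighbour envelope**: `HexAdjEndLo c ⇒ HexEndpointLo z (c+2) 1` for each
neighbour `z` of the origin (`#E_N(z) = #A_N/3` and `e^{-2√N} ≤ 1/3`). [cite: MadrasSlade1993, §3.2 (3.2.1)] -/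
theorem hexEndpointLo_of_adjEndLo {c : ℝ} (h : HexAdjEndLo c) {z : HV} (hz : hvGraph.Adj hvOrigin z) :
    HexEndpointLo z (c + 2) 1 := by
  obtain ⟨m₀, hm₀⟩ := h
  have hμ := hexConnectiveConstant_pos
  refine ⟨m₀, fun m hm => ?_⟩
  set N := 2 * m + 1 with hN
  have hN1 : 1 ≤ N := by omega
  have hz' : #(endFin z N) = #(endFin nb0 N) := by
    rcases (adj_hvOrigin_iff z).1 hz with rfl | rfl | rfl
    · rfl
    · exact card_endFin_nb1 N
    · exact card_endFin_nb2 N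
  have hA : (#(adjEndFin N) : ℝ) = 3 * #(endFin z N) := by
    rw [hz']; exact_mod_cast card_adjEndFin N
  have h1 := hm₀ m hm
  rw [← hN] at h1
  rw [hA] at h1
  -- `e^{-(c+2)√N} μ^N = e^{-2√N} · e^{-c√N} μ^N ≤ (1/3) · 3 #E = #E`
  have hsplit : Real.exp (-((c + 2) * Real.sqrt (N : ℝ))) =
      Real.exp (-(2 * Real.sqrt (N : ℝ))) * Real.exp (-(c * Real.sqrt (N : ℝ))) := by
    rw [← Real.exp_add]; congr 1; ring
  have h3 := exp_neg_two_sqrt_le hN1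
  have hpow : (0 : ℝ) ≤ Real.exp (-(c * Real.sqrt (N : ℝ))) * hexConnectiveConstant ^ N := by positivity
  calc Real.exp (-((c + 2) * Real.sqrt (N : ℝ))) * hexConnectiveConstant ^ N
      = Real.exp (-(2 * Real.sqrt (N : ℝ))) * (Real.exp (-(c * Real.sqrt (N : ℝ))) * hexConnectiveConstant ^ N) := by
        rw [hsplit]; ring
    _ ≤ (1 / 3) * (3 * #(endFin z N)) := mul_le_mul h3 h1 hpow (by norm_num)
    _ = #(endFin z N) := by ring

/-- **The polygon two-step ratio on `ℍ`, per neighbour (Theorem 7.3.4 (c) on `ℍ`, conditional)**: given the polygon lower envelope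
`HexAdjEndLo c`, for each neighbour `z` of the origin `#E_{2m+3}(z)/#E_{2m+1}(z) → 2 + √2` — the number of rooted `(2m+4)`-gons
through the edge `{0,z}` over the number of rooted `(2m+2)`-gons through it. [cite: MadrasSlade1993, Theorem 7.3.4 (c) p. 248;
DuminilCopinSmirnov2012, Theorem 1] -/
theorem hexPolygonRatioTwo_of {c : ℝ} (hc : 0 ≤ c) (h : HexAdjEndLo c) {z : HV} (hz : hvGraph.Adj hvOrigin z) :
    Tendsto (fun m : ℕ => (#(endFin z (2 * m + 1 + 2)) : ℝ) / #(endFin z (2 * m + 1))) atTop (𝓝 (2 + Real.sqrt 2)) :=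
  hexEndpointRatioTwo_of (δ := 1) le_rfl (by linarith) (hexEndpointLo_of_adjEndLo h hz)

/-- **The polygon two-step ratio on `ℍ` (Theorem 7.3.4 (c) on `ℍ`, conditional)**: given `HexAdjEndLo c`,
`#A_{2m+3}/#A_{2m+1} → 2 + √2` — rooted polygons through the origin of lengths `2m+4` over `2m+2`; equivalently
`p_{n+2}(ℍ)/p_n(ℍ) → μ_ℍ² = 2 + √2` along even `n`. Printed and proved for `ℤ^d` only (M–S Thm 7.3.4 (c)); first text for `ℍ`.
[cite: MadrasSlade1993, Theorem 7.3.4 (c) p. 248 and (3.2.1) p. 63; DuminilCopinSmirnov2012, Theorem 1] -/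
theorem hexAdjEndRatioTwo_of {c : ℝ} (hc : 0 ≤ c) (h : HexAdjEndLo c) :
    Tendsto (fun m : ℕ => (#(adjEndFin (2 * m + 1 + 2)) : ℝ) / #(adjEndFin (2 * m + 1))) atTop (𝓝 (2 + Real.sqrt 2)) := by
  have hnb0 : hvGraph.Adj hvOrigin nb0 := (adj_hvOrigin_iff nb0).2 (Or.inl rfl)
  refine (hexPolygonRatioTwo_of hc h hnb0).congr fun m => ?_
  rw [card_adjEndFin, card_adjEndFin]
  push_cast
  have h3 : (3 : ℝ) ≠ 0 := by norm_num
  rw [mul_div_mul_left _ _ h3]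

end Polygon

end Literature.Probability.RandomPlanarGeometry.SAW.HV

end
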